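import Literature.MathematicalPhysics.QuantumFieldTheory.Balaban1983to89.B10Eq27TorusAxialLog
import Literature.MathematicalPhysics.QuantumLattice.BalabanRG
import HarnessLib

/-!
# Route `UnitScaleTilt`, crux K1 «MinimiserStabilityRegPr» (stmt-QuantumFields-19200), route-R E′, architecture (A′) «HCOW-VIA-Σ» (★★OWNER RULING g28-№13), package P-A4
# «CRUDE SLICE ON PRINT'S SLICE», CURVED — FILE (b-T)₁ «THE TORUS CELL»: the NON-NEGATIVE integer representative `ρ(x) ∈ [0, N)^d` of a torus site `x` relative to a base
# point `y` (`N` the period), `y + ρ(x) = x`, `ρ(y + z) = z` on the cell, NO WRAP-AROUND for a forward step strictly inside the cell, and — for a block size `ℓ ∣ N` — the block of a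
# forward step changes EXACTLY when the offset `ρ(x)_μ mod ℓ` is `ℓ − 1` (so an intra-block bond never wraps, and an inter-block bond has both ends on the bubble's boundary layer)

Cell `ym3-torus`, width seat `ym3-torus-px19` (gen 5); pens of record px12 g5 2026-08-29 02:39:52Z ∕ px11 g5 03:15:50Z: (b-T) «TORUS ENERGY» = px19 (this file + the member energy knit),
(b-ℤ) «COMPETITOR ON THE PULLBACK» = px11, (a) + F3 = px12.  WHY: the (A′) lane's slice hypothesis and comb averages live on the `ℤ^d` pullback based at `basePt` (lit `transl`∕`pull`),
blocks `blockMap (L^k)` corner-anchored at `Lᵏ·y` — aligned with the cell `[0, N)^d`, NOT with the symmetric window of lit `rel` (`valMinAbs`); the member energy is a sum over the torus.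
The competitor is built on the pullback (px11) and read on the torus through `ρ`; this file is the bookkeeping both (b-T) and px12's (a) need.  THEOREMS ONLY (0 `def`, 0 `sorry`):
`ρ` is a FREE symbol with the defining hypothesis `hρ : ρ x ν = ((x ν − y ν).val : ℤ)` (consumers: `fun x ν => ((x ν − y ν).val : ℤ)`, `fun _ _ => rfl`).
`--supports stmt-QuantumFields-19200 --as helper`, count-neutral.  YM₃ on T³ is a ladder rung (R3), not the Clay problem; nothing here claims `bern_P`, `hcoW`, E′, a stub, the crux,
d = 4 or the mass gap.

WHAT IS PROVED (ns `…Theorems.Prop7TorusCellRepr`; any `P : Params`, level `j`, base point `y : Site P j`, `N := P.sitesPerDir j`).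
* §1 `transl_cellRepr` (`y + ρ x = x`), `cellRepr_nonneg`, `cellRepr_lt` (`0 ≤ ρ x ν < N`), `cellRepr_transl_of_mem_cell` (`ρ (y + z) = z` for `z ∈ [0,N)^d`), `cellRepr_injective`,
  ★ `cellRepr_shift_of_lt` (`ρ x μ + 1 < N → ρ (x + e_μ) = ρ x + e_μ`).
* §2 (block size `ℓ`, `ℓ ∣ N`): `emod_ne_pred_of_succ_eq` ∕ ★ `cellRepr_succ_lt_of_emod_ne` (`ρ x μ mod ℓ ≠ ℓ − 1 → ρ x μ + 1 < N` — an intra-block step never wraps the cell),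
  ★ `blockMap_add_e_eq_of_emod_ne` (`z_μ mod ℓ ≠ ℓ − 1 → blockMap ℓ (z + e_μ) = blockMap ℓ z`), ★ `emod_eq_pred_of_blockMap_add_e_ne` (contrapositive: the block changes only on the
  boundary layer `z_μ mod ℓ = ℓ − 1`), `emod_add_e_eq_zero_of_emod_eq_pred` (then `(z + e_μ)_μ mod ℓ = 0`: the far end is on the next block's boundary layer).
HONEST SCOPE.  Integer ∕ `ZMod` bookkeeping; no analysis.

References: T. Bałaban, CMP 109 (1987) 249–301 [Balaban1987RG1] ((0.1) p.251: the torus sites); CMP 96 (1984) 223–250 [Balaban1984PropagatorsII] (§1: blocks).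
-/

set_option autoImplicit false

noncomputable section

namespace Summit.QuantumFields.YangMills.Theorems.Prop7TorusCellRepr

open Literature.MathematicalPhysics.QuantumFieldTheory.Balaban1983to89
open B7Prop1Explicit renaming Site → LSite
open B7Prop1Explicit (e e_apply)
open B10Eq27TorusAxialLog (transl transl_apply transl_add_e)
open Literature.MathematicalPhysics.QuantumLattice (blockMap)

variable {P : Params} {j : ℕ} (y : Site P j) (ρ : Site P j → LSite P.d) (hρ : ∀ (x : Site P j) (ν : Fin P.d), ρ x ν = (((x ν - y ν).val : ℕ) : ℤ))

/-! ## §1 The cell representative -/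

section Cell
include hρ

/-- `y + ρ(x) = x`: the cell representative is a section of `transl y`. [cite: Balaban1987RG1, (0.1) p.251] -/
theorem transl_cellRepr (x : Site P j) : transl y (ρ x) = x := by
  funext ν
  rw [transl_apply, hρ, Int.cast_natCast, ZMod.natCast_zmod_val, add_sub_cancel]

/-- `0 ≤ ρ(x)_ν`. [folklore] -/
theorem cellRepr_nonneg (x : Site P j) (ν : Fin P.d) : 0 ≤ ρ x ν := by
  rw [hρ]; exact Int.natCast_nonneg _

/-- `ρ(x)_ν < N`. [folklore] -/
theorem cellRepr_lt (x : Site P j) (ν : Fin P.d) : ρ x ν < P.sitesPerDir j := by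
  rw [hρ]; exact_mod_cast ZMod.val_lt _

/-- `ρ(y + z) = z` for `z` in the cell `[0, N)^d`. [cite: Balaban1987RG1, (0.1) p.251] -/
theorem cellRepr_transl_of_mem_cell (z : LSite P.d) (hz : ∀ ν, 0 ≤ z ν ∧ z ν < P.sitesPerDir j) : ρ (transl y z) = z := by
  funext ν
  rw [hρ, transl_apply, add_sub_cancel_left, ZMod.val_intCast]
  exact Int.emod_eq_of_lt (hz ν).1 (hz ν).2

/-- `ρ` is injective (indeed `transl y ∘ ρ = id`). [folklore] -/
theorem cellRepr_injective : Function.Injective ρ := fun x x' h => by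
  rw [← transl_cellRepr y ρ hρ x, ← transl_cellRepr y ρ hρ x', h]

/-- ★ **NO WRAP-AROUND**: if `ρ(x)_μ + 1 < N` then `ρ(x + e_μ) = ρ(x) + e_μ`. [cite: Balaban1987RG1, (0.1) p.251] -/
theorem cellRepr_shift_of_lt (x : Site P j) (μ : Fin P.d) (h : ρ x μ + 1 < P.sitesPerDir j) : ρ (x.shift μ) = ρ x + e μ := by
  have hx : x.shift μ = transl y (ρ x + e μ) := by rw [transl_add_e, transl_cellRepr y ρ hρ x]
  rw [hx]
  refine cellRepr_transl_of_mem_cell y ρ hρ _ fun ν => ?_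
  rw [Pi.add_apply, e_apply]
  by_cases hν : ν = μ
  · subst hν
    rw [if_pos rfl]
    exact ⟨by have := cellRepr_nonneg y ρ hρ x ν; linarith, h⟩
  · rw [if_neg hν, add_zero]
    exact ⟨cellRepr_nonneg y ρ hρ x ν, cellRepr_lt y ρ hρ x ν⟩

end Cell

/-! ## §2 Blocks of side `ℓ ∣ N`: the block of a forward step changes exactly on the boundary layer -/

section Blocks

/-- If `ℓ ∣ N`, `a < N` and `a mod ℓ ≠ ℓ − 1`, then `a + 1 < N` (since `N − 1 ≡ ℓ − 1 (mod ℓ)`). [folklore] -/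
theorem succ_lt_of_emod_ne {ℓ N : ℕ} (hℓ : 0 < ℓ) (hdvd : ℓ ∣ N) {a : ℤ} (haN : a < N) (hne : a % (ℓ : ℤ) ≠ (ℓ : ℤ) - 1) :
    a + 1 < N := by
  rcases lt_or_eq_of_le (Int.add_one_le_iff.mpr haN) with h | h
  · exact h
  · exfalso
    apply hne
    obtain ⟨c, hc⟩ := hdvd
    have hℓZ : (0 : ℤ) < ℓ := by exact_mod_cast hℓ
    have ha : a = (ℓ : ℤ) * c - 1 := by
      have : (N : ℤ) = (ℓ : ℤ) * c := by exact_mod_cast hc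
      linarith
    rw [ha]
    have e1 : (ℓ : ℤ) * c - 1 = ((ℓ : ℤ) - 1) + (ℓ : ℤ) * (c - 1) := by ring
    rw [e1, Int.add_mul_emod_self_left]
    exact Int.emod_eq_of_lt (by linarith) (by linarith)

include hρ in
/-- ★ **AN INTRA-BLOCK STEP NEVER WRAPS THE CELL**: `ρ(x)_μ mod ℓ ≠ ℓ − 1` (⟺ `x + e_μ` in the same `ℓ`-block) ⟹ `ρ(x)_μ + 1 < N`, hence `ρ(x + e_μ) = ρ(x) + e_μ`.
[cite: Balaban1984PropagatorsII, (2.7)-(2.12) pp.224-225] -/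
theorem cellRepr_shift_of_emod_ne {ℓ : ℕ} (hℓ : 0 < ℓ) (hdvd : ℓ ∣ P.sitesPerDir j) (x : Site P j) (μ : Fin P.d)
    (hne : ρ x μ % (ℓ : ℤ) ≠ (ℓ : ℤ) - 1) : ρ (x.shift μ) = ρ x + e μ :=
  cellRepr_shift_of_lt y ρ hρ x μ (succ_lt_of_emod_ne hℓ hdvd (cellRepr_lt y ρ hρ x μ) hne)

/-- ★ **SAME BLOCK OFF THE BOUNDARY LAYER**: `z_μ mod ℓ ≠ ℓ − 1 ⟹ blockMap ℓ (z + e_μ) = blockMap ℓ z` (floor division: `(a+1)∕ℓ = a∕ℓ` unless `a ≡ −1`).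
[cite: Balaban1984PropagatorsII, (2.7)-(2.12) pp.224-225] -/
theorem blockMap_add_e_eq_of_emod_ne {d ℓ : ℕ} (hℓ : 0 < ℓ) (z : LSite d) (μ : Fin d) (hne : z μ % (ℓ : ℤ) ≠ (ℓ : ℤ) - 1) :
    blockMap ℓ (z + e μ) = blockMap ℓ z := by
  funext i
  simp only [blockMap, Pi.add_apply, e_apply]
  by_cases hi : i = μ
  · subst hi
    rw [if_pos rfl]
    have hℓZ : (0 : ℤ) < ℓ := by exact_mod_cast hℓ
    have hdm := Int.emod_add_mul_ediv (z i) (ℓ : ℤ)      -- z i % ℓ + ℓ * (z i / ℓ) = z i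
    have hr0 := Int.emod_nonneg (z i) hℓZ.ne'
    have hrl := Int.emod_lt_of_pos (z i) hℓZ
    set r := z i % (ℓ : ℤ) with hr
    set q := z i / (ℓ : ℤ) with hq
    have hz : z i + 1 = (r + 1) + ℓ * q := by linarith
    rw [hz, Int.add_mul_ediv_left _ _ hℓZ.ne', Int.ediv_eq_zero_of_lt (by linarith) (by omega), zero_add]
  · rw [if_neg hi, add_zero]

/-- ★ **THE BLOCK CHANGES ONLY ON THE BOUNDARY LAYER** (contrapositive): `blockMap ℓ (z + e_μ) ≠ blockMap ℓ z ⟹ z_μ mod ℓ = ℓ − 1`.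
[cite: Balaban1984PropagatorsII, (2.7)-(2.12) pp.224-225] -/
theorem emod_eq_pred_of_blockMap_add_e_ne {d ℓ : ℕ} (hℓ : 0 < ℓ) (z : LSite d) (μ : Fin d) (hne : blockMap ℓ (z + e μ) ≠ blockMap ℓ z) :
    z μ % (ℓ : ℤ) = (ℓ : ℤ) - 1 := by
  by_contra h
  exact hne (blockMap_add_e_eq_of_emod_ne hℓ z μ h)

/-- **THE FAR END OF A BOUNDARY STEP IS ON THE NEXT BOUNDARY LAYER**: `z_μ mod ℓ = ℓ − 1 ⟹ (z + e_μ)_μ mod ℓ = 0`. [folklore] -/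
theorem emod_add_e_eq_zero_of_emod_eq_pred {d ℓ : ℕ} (hℓ : 0 < ℓ) (z : LSite d) (μ : Fin d) (h : z μ % (ℓ : ℤ) = (ℓ : ℤ) - 1) :
    (z + e μ) μ % (ℓ : ℤ) = 0 := by
  rw [Pi.add_apply, e_apply, if_pos rfl, Int.add_emod, h]
  have h1le : (1 : ℤ) ≤ ℓ := by exact_mod_cast hℓ
  rcases eq_or_lt_of_le h1le with h1 | h1
  · -- ℓ = 1
    rw [← h1]; simp
  · rw [Int.emod_eq_of_lt (by norm_num) h1, sub_add_cancel, Int.emod_self]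

/-- The other coordinates of a forward step are unchanged: `(z + e_μ)_ν = z_ν` for `ν ≠ μ`. [folklore] -/
theorem add_e_apply_of_ne {d : ℕ} (z : LSite d) {μ ν : Fin d} (h : ν ≠ μ) : (z + e μ) ν = z ν := by
  rw [Pi.add_apply, e_apply, if_neg h, add_zero]

/-- `(z + e_μ)_μ = z_μ + 1`. [folklore] -/
theorem add_e_apply_self {d : ℕ} (z : LSite d) (μ : Fin d) : (z + e μ) μ = z μ + 1 := by
  rw [Pi.add_apply, e_apply, if_pos rfl]

end Blocks

end Summit.QuantumFields.YangMills.Theorems.Prop7TorusCellRepr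

end
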